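import Summits.Ventures.PercRepro.C025ProfileGen

/-!
# Corollaries of the row (2,3) in the crux's vocabulary (night-3 g8)

`profileIneq_two_three` restricted to the bottom sets of `(p, 2)` (the rank-`2` sets with spanning complement of rank `p`,
`PerFlat.Uq M p 2`) is the level-`3` term of `C025` at `(p, 2)` for EVERY `p ≥ 3`, uniformly in `p`:
`#Uq(p,2) · C(p+2,3)/C(p+2,2) ≤ #{S : ρ(S) = 3}`, i.e. `p · #Uq(p,2) ≤ 3 · #{S : ρ(S) = 3}` — by the tree's
`Profile.card_Uq_mul_le_card_Lq` (the bridge of night-3 g6). At `p = 4` it is Theorem H `4·#U ≤ 3·#Y` (the cell's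
`(4,2)`); at every `p ≥ 5` it is the new level-`3` inequality that the `(p,2)` cell map of `C025` sums with the levels
`4 … p−1`.
-/

open scoped Matroid

namespace PercRepro

open Set Finset ThmH

section GenCor

variable {α : Type} [DecidableEq α]

/-- **The level-`3` term of `C025` at `(p, 2)`, every `p ≥ 3`, every finite matroid.** -/
theorem card_Uq_two_mul_le_card_levelSet_three (M : Matroid α) [M.Finite] {p : ℕ} (hp : 3 ≤ p) :
    ((PerFlat.Uq M p 2).card : ℚ) * ((Nat.choose (p + 2) 3 : ℚ) / (Nat.choose (p + 2) 2 : ℚ)) ≤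
      ((Shadow.levelSet M 3).card : ℚ) :=
  Profile.card_Uq_mul_le_card_Lq hp (profileIneq_two_three M)

/-- The same in integers: `p · #Uq(p,2) ≤ 3 · #{S : ρ(S) = 3}`. -/
theorem mul_card_Uq_two_le_three_mul_card_levelSet_three (M : Matroid α) [M.Finite] {p : ℕ} (hp : 3 ≤ p) :
    p * (PerFlat.Uq M p 2).card ≤ 3 * (Shadow.levelSet M 3).card := by
  have h := card_Uq_two_mul_le_card_levelSet_three M hp
  rw [choose_ratio_two_three] at h
  have h' : (p : ℚ) * ((PerFlat.Uq M p 2).card : ℚ) ≤ 3 * ((Shadow.levelSet M 3).card : ℚ) := by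
    have hU : (0 : ℚ) ≤ ((PerFlat.Uq M p 2).card : ℚ) := Nat.cast_nonneg _
    have : ((PerFlat.Uq M p 2).card : ℚ) * ((p : ℚ) / 3) ≤ ((Shadow.levelSet M 3).card : ℚ) := h
    rw [mul_div_assoc', div_le_iff₀ (by norm_num)] at this
    linarith
  exact_mod_cast h'

end GenCor

end PercRepro
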